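import Literature.NumberTheory.EllipticCurves.KummerImageIsotropyProofs
import HarnessLib

/-!
# Compatibility of the Weil pairings along the level: `e_{mm'}(S, T) = e_m(m'S, T)` (Silverman, *AEC*, III.8.1 (e))

`Proofs` file (theorems only: no definition, no named fact, no instance; D-0026) in topic
`NumberTheory/EllipticCurves`, next to `WeilPairingProofs.lean`, whose CONSTRUCTED Weil pairing
`WeierstrassCurve.weilPairingFun hm S T = τ_S^* h_T / h_T` (`h_T` a Weil function for `T` at level `m`,
`div h_T = Σ_{R ∈ E[m]} (T' + R) - (R)`, `m T' = T`) is proved there to be bilinear, alternating,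
non-degenerate and Galois equivariant (Silverman, *AEC*, Prop. III.8.1 (a)–(d);
`exists_weilPairing_holds`). This file adds property **(e)** of the same proposition:

> (e) It is compatible: `e_{mm'}(S, T) = e_m([m']S, T)` for all `S ∈ E[mm']` and `T ∈ E[m]`

for the SAME functions `weilPairingFun` — so that the tree's Weil pairings at the levels `m ∣ m m'`
form a genuinely compatible system (before this file the tree knew the Weil pairing "only level by
level … with no compatibility", module docstring of `WeilPairingLevelDescent.lean`, which therefore
had to DERIVE a level-`d` pairing from a level-`kd` one). Consequences recorded here:

* `IsWeilFunction.pullbackHom_zsmul` — **`[m']^* h_T` is a Weil function for `T` at level `m m'`**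
  (root `T''` with `m' T'' = T'`; `[m']` is unramified, `ord_P ([m']^* u) = ord_{m'P} (u)`, the tree's
  `ord_pullbackHom_zsmul`, and `𝟙_{E[m]}(m'Q) = 𝟙_{E[mm']}(Q)`);
* **`weilPairingFun_mul`** — (e): `e_{mm'}(S, T) = e_m(m'S, T)` (`S ∈ E[mm']`, `T ∈ E[m]`): apply
  `τ_S^*` to `[m']^* h_T` and use `τ_S^* ∘ [m']^* = [m']^* ∘ τ_{m'S}^*`
  (`transAlgHom_pullbackHom_zsmul`);
* the symmetric compatibility `weilPairingFun_mul_right`: `e_{mm'}(T, S) = e_m(T, m'S)` (from (e)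
  and the skew-symmetry `e(S,T) e(T,S) = 1` of `KummerImageIsotropyProofs.lean`), and
  `weilPairingFun_zsmul_zsmul`: `e_m(m'S, m'T') = e_{mm'}(S, T')^{m'}`;
* the `p`-power tower: **`weilPairingFun_pow_succ`**, `e_{p^k}(pS, pT) = e_{p^{k+1}}(S, T)^p` for
  `S, T ∈ E[p^{k+1}]`, and the packaged existence statement `exists_weilPairing_tower` (one family
  `e_k : E[p^k] × E[p^k] → μ_{p^k}`, `k ≥ 0`, each level bilinear/alternating/non-degenerate/
  Galois-equivariant, COMPATIBLE along `[p]`) — the input that makes finite-coefficient local Tate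
  pairings `inv(x̄_k ∪_{e_k} δ_k Q)` of an elliptic curve compatible in `k` (Perrin-Riou's `Λ`-adic
  pairing as a limit of finite-level pairings, [PerrinRiou1994Invent] §3.6.1; Kato §13.8).

Declarations are deliberate dot-notation extensions in Mathlib's `WeierstrassCurve` namespace, next
to `WeierstrassCurve.weilPairingFun` (as `WeilPairingProofs.lean`).

## References

* [SilvermanAEC2009] J. H. Silverman, *The Arithmetic of Elliptic Curves*, 2nd ed., GTM 106 (2009),
  **Prop. III.8.1 (e)** and its proof (p. 95: "`div(g ∘ [m']) = [m']^* div(g)` … so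
  `e_{mm'}(S,T) = (g∘[m'])(X+S)/(g∘[m'])(X) = g(Y + [m']S)/g(Y) = e_m([m']S, T)`"),
  Thm. III.4.10 (c) (`[m']` unramified).
* [PerrinRiou1994Invent] B. Perrin-Riou, *Théorie d'Iwasawa des représentations p-adiques sur un
  corps local*, Invent. Math. 115 (1994), §3.6.1 (motivation only).
-/

noncomputable section

open scoped Classical

universe u

namespace WeierstrassCurve

open geomPoints Literature.NumberTheory.EllipticCurves.WeierstrassFunctionField

variable {F : Type u} [Field F] {W : WeierstrassCurve F} [W.IsElliptic]

/-! ## `𝟙_{E[m]}(m' Q) = 𝟙_{E[mm']}(Q)` and the pull-back of Weil functions along `[m']` -/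

omit [W.IsElliptic] in
/-- `𝟙_{E[m]}(m' Q) = 𝟙_{E[m m']}(Q)`: `m (m' Q) = O ↔ (m m') Q = O` (the identity
`[m']^{-1} E[m] = E[mm']` behind `div(g ∘ [m']) = [m']^* div(g)` in Silverman's proof of III.8.1 (e)).
[cite: SilvermanAEC2009, Prop. III.8.1(e) (proof)] -/
theorem torsionInd_zsmul (m m' : ℕ) (Q : W.geomPoints) :
    torsionInd W m ((m' : ℤ) • Q) = torsionInd W (m * m') Q := by
  unfold torsionInd
  rw [smul_smul, ← Nat.cast_mul]

/-- **`[m']^* h` is a Weil function for `T` at level `m m'`** whenever `h` is a Weil function for `T`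
at level `m` (Silverman, *AEC*, III.§8, p. 95: `div(g ∘ [m']) = [m']^*(div g)`): with `m T' = T` and
`m' T'' = T'` one has `(m m') T'' = T` and, `[m']` being unramified (`ord_P ([m']^* h) = ord_{m'P}(h)`,
the tree's `ord_pullbackHom_zsmul`),
`ord_P ([m']^* h) = 𝟙_{E[m]}(m'P - T') - 𝟙_{E[m]}(m'P) = 𝟙_{E[mm']}(P - T'') - 𝟙_{E[mm']}(P)`.
[cite: SilvermanAEC2009, Prop. III.8.1(e) (proof)] -/
theorem IsWeilFunction.pullbackHom_zsmul {m m' : ℕ} (hm'Z : (m' : ℤ) ≠ 0) (hm'F : ((m' : ℤ) : F) ≠ 0)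
    {T : W.geomPoints} {h : W.geomFunctionField} (hh : IsWeilFunction W m T h) :
    IsWeilFunction W (m * m') T ((Isogeny.zsmul W (m' : ℤ) hm'Z).pullbackHom h) := by
  obtain ⟨h0, T', hT', hord⟩ := hh
  refine ⟨(map_ne_zero_iff _ (Isogeny.zsmul W (m' : ℤ) hm'Z).pullbackHom.injective).mpr h0, ?_⟩
  obtain ⟨T'', hT''⟩ := zsmul_geomPoints_surjective_holds W hm'Z T'
  change (m' : ℤ) • T'' = T' at hT''
  refine ⟨T'', ?_, fun P ↦ ?_⟩
  · rw [Nat.cast_mul, ← smul_smul, hT'', hT']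
  · rw [ord_pullbackHom_zsmul hm'Z hm'F P h, hord, ← hT'', ← smul_sub, torsionInd_zsmul,
      torsionInd_zsmul]

/-! ## Property (e): `e_{mm'}(S, T) = e_m(m'S, T)` -/

section Compat

variable {m m' : ℕ} (hm : (m : F) ≠ 0) (hmm' : ((m * m' : ℕ) : F) ≠ 0)
include hmm'

omit [W.IsElliptic] in
/-- `m' ≠ 0` in `F` (proof-local). [folklore] -/
private theorem natCast_right_ne_zero : (m' : F) ≠ 0 := fun h ↦
  hmm' (by rw [Nat.cast_mul, h, mul_zero])

omit [W.IsElliptic] in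
/-- `m' ≠ 0` in `ℤ` (proof-local). [folklore] -/
private theorem intCast_right_ne_zero : (m' : ℤ) ≠ 0 := by
  have h : m' ≠ 0 := fun h0 ↦ natCast_right_ne_zero hmm' (by rw [h0, Nat.cast_zero])
  exact_mod_cast h

omit [W.IsElliptic] in
/-- `(m' : ℤ) ≠ 0` in `F` (proof-local). [folklore] -/
private theorem intCast_cast_right_ne_zero : ((m' : ℤ) : F) ≠ 0 := by
  rw [Int.cast_natCast]
  exact natCast_right_ne_zero hmm'

include hm

/-- **Compatibility of the Weil pairings (Silverman, *AEC*, Prop. III.8.1 (e))**: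
`e_{mm'}(S, T) = e_m(m' S, T)` for `S ∈ E[m m']` and `T ∈ E[m]`, for the tree's constructed pairings
`weilPairingFun` at the levels `m m'` and `m`. Proof (loc. cit., p. 95): if `h` is a Weil function for
`T` at level `m`, then `[m']^* h` is one at level `m m'` (`IsWeilFunction.pullbackHom_zsmul`), so
`τ_S^* ([m']^* h) = e_{mm'}(S, T) · [m']^* h`; but `τ_S^* ∘ [m']^* = [m']^* ∘ τ_{m'S}^*`
(`transAlgHom_pullbackHom_zsmul`) and `τ_{m'S}^* h = e_m(m'S, T) · h`, while `[m']^*` fixes constants.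
[cite: SilvermanAEC2009, Prop. III.8.1(e)] -/
theorem weilPairingFun_mul {S T : W.geomPoints} (hS : ((m * m' : ℕ) : ℤ) • S = 0)
    (hT : (m : ℤ) • T = 0) :
    weilPairingFun hmm' S T = weilPairingFun hm ((m' : ℤ) • S) T := by
  have hm'Z : (m' : ℤ) ≠ 0 := intCast_right_ne_zero hmm'
  have hm'F : ((m' : ℤ) : F) ≠ 0 := intCast_cast_right_ne_zero hmm'
  have hh := isWeilFunction_weilFn hm hT
  have hh'' := hh.pullbackHom_zsmul hm'Z hm'F
  have hT₂ : ((m * m' : ℕ) : ℤ) • T = 0 := by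
    rw [Nat.cast_mul, mul_comm, ← smul_smul, hT, smul_zero]
  have hm'S : (m : ℤ) • ((m' : ℤ) • S) = 0 := by rw [smul_smul, ← Nat.cast_mul, hS]
  have h1 := hh''.transAlgHom_eq hmm' hS hT₂
  rw [transAlgHom_pullbackHom_zsmul hm'Z, hh.transAlgHom_eq hm hm'S hT, map_mul,
    AlgHom.commutes] at h1
  exact (algebraMap_mul_cancel hh''.1 h1).symm

omit hmm' in
/-- `e(T, S) = e(S, T)⁻¹` for `S, T ∈ E[m]` (skew-symmetry `e(S,T) e(T,S) = 1`, the tree's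
`weilPairingFun_mul_comm_eq_one`). Silverman, *AEC*, proof of Prop. III.8.1 (b).
[cite: SilvermanAEC2009, Prop. III.8.1(b)] -/
theorem weilPairingFun_swap_eq_inv {S T : W.geomPoints} (hS : (m : ℤ) • S = 0) (hT : (m : ℤ) • T = 0) :
    weilPairingFun hm T S = (weilPairingFun hm S T)⁻¹ :=
  eq_inv_of_mul_eq_one_right (weilPairingFun_mul_comm_eq_one hm hS hT)

/-- **Compatibility in the second variable**: `e_{mm'}(T, S) = e_m(T, m'S)` for `T ∈ E[m]`,
`S ∈ E[m m']` (from (e) and skew-symmetry). [cite: SilvermanAEC2009, Prop. III.8.1(e)] -/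
theorem weilPairingFun_mul_right {S T : W.geomPoints} (hS : ((m * m' : ℕ) : ℤ) • S = 0)
    (hT : (m : ℤ) • T = 0) :
    weilPairingFun hmm' T S = weilPairingFun hm T ((m' : ℤ) • S) := by
  have hT₂ : ((m * m' : ℕ) : ℤ) • T = 0 := by
    rw [Nat.cast_mul, mul_comm, ← smul_smul, hT, smul_zero]
  have hm'S : (m : ℤ) • ((m' : ℤ) • S) = 0 := by rw [smul_smul, ← Nat.cast_mul, hS]
  rw [weilPairingFun_swap_eq_inv hmm' hS hT₂, weilPairingFun_swap_eq_inv hm hm'S hT,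
    weilPairingFun_mul hm hmm' hS hT]

/-- **(e) with both arguments moved**: `e_{mm'}(S, T')^{m'} = e_m(m'S, m'T')` for `S, T' ∈ E[m m']`
(`e_{mm'}(S, T')^{m'} = e_{mm'}(S, m'T') = e_m(m'S, m'T')`). [cite: SilvermanAEC2009, Prop. III.8.1(e)] -/
theorem weilPairingFun_zsmul_zsmul {S T' : W.geomPoints} (hS : ((m * m' : ℕ) : ℤ) • S = 0)
    (hT' : ((m * m' : ℕ) : ℤ) • T' = 0) :
    weilPairingFun hm ((m' : ℤ) • S) ((m' : ℤ) • T') = weilPairingFun hmm' S T' ^ m' := by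
  have hm'T' : (m : ℤ) • ((m' : ℤ) • T') = 0 := by rw [smul_smul, ← Nat.cast_mul, hT']
  rw [← weilPairingFun_mul hm hmm' hS hm'T', natCast_zsmul, weilPairingFun_nsmul_right hmm' hS hT']

end Compat

/-! ## The `p`-power tower -/

section Tower

variable {p : ℕ}

/-- **The `p`-power Weil pairings are compatible along `[p]`**: for `S, T ∈ E[p^{k+1}]`,
`e_{p^k}(pS, pT) = e_{p^{k+1}}(S, T)^p` (Silverman, *AEC*, Prop. III.8.1 (e) with `m = p^k`,
`m' = p`, and linearity). This is the transition law making `(e_{p^k})_k` a pairing of inverse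
systems `E[p^{k+1}] →[p] E[p^k]`, `μ_{p^{k+1}} →[(·)^p] μ_{p^k}`, i.e. a pairing
`T_p E × T_p E → ℤ_p(1)` on the Tate module. [cite: SilvermanAEC2009, Prop. III.8.1(e)] -/
theorem weilPairingFun_pow_succ (k : ℕ) (hk : ((p ^ k : ℕ) : F) ≠ 0)
    (hk1 : ((p ^ (k + 1) : ℕ) : F) ≠ 0) {S T : W.geomPoints}
    (hS : ((p ^ (k + 1) : ℕ) : ℤ) • S = 0) (hT : ((p ^ (k + 1) : ℕ) : ℤ) • T = 0) :
    weilPairingFun hk ((p : ℤ) • S) ((p : ℤ) • T) = weilPairingFun hk1 S T ^ p := by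
  have hk1' : ((p ^ k * p : ℕ) : F) ≠ 0 := by rwa [← pow_succ]
  have hS' : ((p ^ k * p : ℕ) : ℤ) • S = 0 := by rwa [← pow_succ]
  have hT' : ((p ^ k * p : ℕ) : ℤ) • T = 0 := by rwa [← pow_succ]
  have key := weilPairingFun_zsmul_zsmul hk hk1' hS' hT'
  rw [key]
  -- the two level-`p^{k+1}` pairings are the same function (the level `p^k * p = p^(k+1)`)
  congr 1

/-- **A compatible tower of Weil pairings `e_k : E[p^k] × E[p^k] → μ_{p^k}` (`k ≥ 0`)** for an
elliptic curve over a field `F` with `p ≠ 0` in `F`: ONE family, each level bilinear, alternating,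
non-degenerate and `Γ_F`-equivariant (Silverman, *AEC*, Prop. III.8.1 (a)–(d), the tree's
`exists_weilPairing_holds` level by level), and COMPATIBLE: `e_k(pS, pT) = e_{k+1}(S, T)^p` for
`S, T ∈ E[p^{k+1}]` (Prop. III.8.1 (e)). The family is `e_k = weilPairingFun` at level `p^k`.
[cite: SilvermanAEC2009, Prop. III.8.1 (a)–(e)] -/
theorem exists_weilPairing_tower (hp : (p : F) ≠ 0) :
    ∃ e : (k : ℕ) → W.geomPoints → W.geomPoints → AlgebraicClosure F,
      (∀ (k : ℕ) (S T : W.geomPoints), ((p ^ k : ℕ) : ℤ) • S = 0 → ((p ^ k : ℕ) : ℤ) • T = 0 →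
        e k S T ^ (p ^ k) = 1) ∧
      (∀ (k : ℕ) (S₁ S₂ T : W.geomPoints), ((p ^ k : ℕ) : ℤ) • S₁ = 0 → ((p ^ k : ℕ) : ℤ) • S₂ = 0 →
        ((p ^ k : ℕ) : ℤ) • T = 0 → e k (S₁ + S₂) T = e k S₁ T * e k S₂ T) ∧
      (∀ (k : ℕ) (S T₁ T₂ : W.geomPoints), ((p ^ k : ℕ) : ℤ) • S = 0 → ((p ^ k : ℕ) : ℤ) • T₁ = 0 →
        ((p ^ k : ℕ) : ℤ) • T₂ = 0 → e k S (T₁ + T₂) = e k S T₁ * e k S T₂) ∧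
      (∀ (k : ℕ) (T : W.geomPoints), ((p ^ k : ℕ) : ℤ) • T = 0 → e k T T = 1) ∧
      (∀ (k : ℕ) (T : W.geomPoints), ((p ^ k : ℕ) : ℤ) • T = 0 →
        (∀ S : W.geomPoints, ((p ^ k : ℕ) : ℤ) • S = 0 → e k S T = 1) → T = 0) ∧
      (∀ (k : ℕ) (σ : Field.absoluteGaloisGroup F) (S T : W.geomPoints), ((p ^ k : ℕ) : ℤ) • S = 0 →
        ((p ^ k : ℕ) : ℤ) • T = 0 → e k (σ • S) (σ • T) = σ • e k S T) ∧
      (∀ (k : ℕ) (S T : W.geomPoints), ((p ^ (k + 1) : ℕ) : ℤ) • S = 0 →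
        ((p ^ (k + 1) : ℕ) : ℤ) • T = 0 → e k ((p : ℤ) • S) ((p : ℤ) • T) = e (k + 1) S T ^ p) := by
  have hk : ∀ k : ℕ, ((p ^ k : ℕ) : F) ≠ 0 := fun k ↦ by
    rw [Nat.cast_pow]
    exact pow_ne_zero k hp
  refine ⟨fun k S T ↦ weilPairingFun (hk k) S T,
    fun k S T hS hT ↦ weilPairingFun_pow (hk k) hS hT,
    fun k S₁ S₂ T hS₁ hS₂ hT ↦ weilPairingFun_add_left (hk k) hS₁ hS₂ hT,
    fun k S T₁ T₂ hS hT₁ hT₂ ↦ weilPairingFun_add_right (hk k) hS hT₁ hT₂,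
    fun k T hT ↦ weilPairingFun_self (hk k) hT,
    fun k T hT h1 ↦ eq_zero_of_weilPairingFun_eq_one (hk k) hT h1,
    fun k σ S T hS hT ↦ weilPairingFun_smul (hk k) σ hS hT,
    fun k S T hS hT ↦ weilPairingFun_pow_succ k (hk k) (hk (k + 1)) hS hT⟩

end Tower

end WeierstrassCurve
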